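import Literature.Combinatorics.Designs.SequenceSumSquares

/-!
# Golay complementary pairs: base sequences from Golay pairs, and the two-squares identity

[Seberry–Yamada, *Hadamard Matrices* (Wiley 2020)] (`SeberryYamada2020`):
* Definition 1.45: two `±1` sequences `a, b` of length `n` with `N_a(j) + N_b(j) = 0` for `j = 1, …, n-1` are
  *Golay complementary sequences* (a Golay pair) of length `n`; such `n` is a *Golay number*.
* §5.9 (before Conjecture 5.5): if `X, Y` are Golay sequences of length `m` then `{1, X}, {1, -X}, {Y}, {Y}` are base
  sequences of lengths `m+1, m+1, m, m` — so `BS(m+1, m)` exist for every Golay number `m = 2^a 10^b 26^c`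
  (`golay_baseSeq`).
* Lemma 1.23: if `k₁` of the `aᵢ` and `k₂` of the `bᵢ` are positive then `n = (k₁ + k₂ - n)² + (k₁ - k₂)²` and `n` is
  even.  With the element sums `x = 2k₁ - n`, `y = 2k₂ - n` the identity reads `x² + y² = 2n` (`golay_sum_sq`); we
  record the consequence `n ≢ 3 (mod 4)` (`golay_length_mod_four`: for odd `n` both sums are odd, `x² + y² ≡ 2
  (mod 8)`, while `2n ≡ 6 (mod 8)` when `n ≡ 3 (mod 4)`).
  -- TODO(general form): Lemma 1.23's full parity statement "`n` is even for `n > 1`" (and the Eliahou–Kervaire–Saffari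
  -- theorem: no prime factor `≡ 3 (mod 4)`) is not formalised here.
Cell pub-namedobj (venture DiscreteObjects), target H: the Golay sub-route to base sequences `BS(84, 84, 83, 83)`
would need a Golay pair of length `83 ≡ 3 (mod 4)`.  No `sorry`, no new axioms.
-/

open Finset BigOperators

namespace Literature.Combinatorics.Designs.GolayPairs

open Literature.Combinatorics.Designs.TSequences
open Literature.Combinatorics.Designs.BaseSequences
open Literature.Combinatorics.Designs.SequenceSums

/-- **Golay complementary pair** of length `n`: two `±1` sequences whose aperiodic autocorrelations sum to `0` at every
shift `1 ≤ j ≤ n - 1`. [cite: SeberryYamada2020, Definition 1.45] -/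
def IsGolayPair (n : ℕ) (a b : ℕ → ℤ) : Prop :=
  PMOn n a ∧ PMOn n b ∧ ∀ s < n, s ≠ 0 → NPAF n a s + NPAF n b s = 0

/-- the autocorrelation condition of a Golay pair at every shift `s ≠ 0`. [cite: SeberryYamada2020, Definition 1.45] -/
lemma IsGolayPair.npaf {n : ℕ} {a b : ℕ → ℤ} (h : IsGolayPair n a b) {s : ℕ} (hs : s ≠ 0) :
    NPAF n a s + NPAF n b s = 0 := by
  by_cases hsn : s < n
  · exact h.2.2 s hsn hs
  · rw [npaf_of_le a (not_lt.mp hsn), npaf_of_le b (not_lt.mp hsn), add_zero]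

/-! ## Base sequences from a Golay pair -/

/-- **Golay pair of length `m` ⇒ base sequences `BS(m+1, m+1, m, m)`**: `({1, X}, {1, -X}, Y, Y)`.
[cite: SeberryYamada2020, §5.9 (before Conjecture 5.5)] -/
theorem golay_baseSeq {m : ℕ} {a b : ℕ → ℤ} (h : IsGolayPair m a b) :
    IsBaseSeq (1 + m) m (cat 1 (fun _ => 1) a) (cat 1 (fun _ => 1) fun i => -a i) b b := by
  obtain ⟨ha, hb, -⟩ := id h
  refine ⟨?_, ?_, hb, hb, ?_⟩
  · intro i hi
    unfold cat
    split_ifs with h1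
    · exact Or.inl rfl
    · exact ha (i - 1) (by omega)
  · intro i hi
    unfold cat
    split_ifs with h1
    · exact Or.inl rfl
    · rcases ha (i - 1) (by omega) with e | e <;> simp [e]
  · intro s _ hs0
    have key := npaf_cat_pair 1 m (fun _ => (1 : ℤ)) a s
    have h1 : NPAF 1 (fun _ => (1 : ℤ)) s = 0 := npaf_of_le _ (by omega)
    have h2 := h.npaf hs0
    linarith

/-! ## The two-squares identity and the residue of the length mod 4 -/

/-- **`x² + y² = 2n`** for the element sums of a Golay pair of length `n` (Lemma 1.23 in the form
`n = (k₁ + k₂ - n)² + (k₁ - k₂)²`). [cite: SeberryYamada2020, Lemma 1.23] -/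
theorem golay_sum_sq {n : ℕ} {a b : ℕ → ℤ} (h : IsGolayPair n a b) :
    (∑ i ∈ range n, a i) ^ 2 + (∑ i ∈ range n, b i) ^ 2 = 2 * n := by
  obtain ⟨ha, hb, hN⟩ := h
  rcases Nat.eq_zero_or_pos n with rfl | hn
  · simp
  · haveI : NeZero n := ⟨hn.ne'⟩
    rw [sq_sum_eq_npaf (L := n), sq_sum_eq_npaf (L := n)]
    have hz : ∑ s ∈ (univ : Finset (ZMod n)).erase 0,
        ((NPAF n a s.val + NPAF n a (n - s.val)) + (NPAF n b s.val + NPAF n b (n - s.val))) = 0 := by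
      refine Finset.sum_eq_zero fun s hs => ?_
      have hs0 : s ≠ 0 := (mem_erase.mp hs).1
      have hv : s.val ≠ 0 := fun e => hs0 ((ZMod.val_eq_zero s).mp e)
      have hlt : s.val < n := ZMod.val_lt s
      have h1 := hN s.val hlt hv
      have h2 := hN (n - s.val) (by omega) (by omega)
      linarith
    rw [Finset.sum_add_distrib] at hz
    rw [npaf_zero_of_pm ha, npaf_zero_of_pm hb]
    linarith

/-- a `±1` sum of length `L` is `L - 2k` for some integer `k`. [folklore] -/
private theorem sum_pm_parity {x : ℕ → ℤ} : ∀ {L : ℕ}, PMOn L x → ∃ k : ℤ, ∑ i ∈ range L, x i = L - 2 * k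
  | 0, _ => ⟨0, by simp⟩
  | L + 1, hx => by
      obtain ⟨k, hk⟩ := sum_pm_parity (L := L) fun i hi => hx i (Nat.lt_succ_of_lt hi)
      rw [Finset.sum_range_succ, hk]
      rcases hx L (Nat.lt_succ_self L) with h | h
      · exact ⟨k, by rw [h]; push_cast; ring⟩
      · exact ⟨k + 1, by rw [h]; push_cast; ring⟩

/-- the residue computation: `(4q+3-2k)² + (4q+3-2l)² ≠ 2(4q+3)` modulo `8`. [folklore] -/
private lemma key_mod_eight : ∀ q k l : ZMod 8,
    (4 * q + 3 - 2 * k) ^ 2 + (4 * q + 3 - 2 * l) ^ 2 ≠ 2 * (4 * q + 3) := by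
  decide

/-- **the length of a Golay pair is not `≡ 3 (mod 4)`**: for such `n` the element sums are odd, `x² + y² ≡ 2 (mod 8)`
but `2n ≡ 6 (mod 8)` — the `n ≡ 3 (mod 4)` case of "a Golay number is even" / "has no prime factor `≡ 3 (mod 4)`".
[cite: SeberryYamada2020, Lemma 1.23] -/
theorem golay_length_mod_four {n : ℕ} {a b : ℕ → ℤ} (h : IsGolayPair n a b) : n % 4 ≠ 3 := by
  intro h3
  have hsq := golay_sum_sq h
  obtain ⟨k, hk⟩ := sum_pm_parity h.1
  obtain ⟨l, hl⟩ := sum_pm_parity h.2.1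
  obtain ⟨q, hq⟩ : ∃ q, n = 4 * q + 3 := ⟨n / 4, by omega⟩
  rw [hk, hl, hq] at hsq
  push_cast at hsq
  have hcast := congrArg (fun z : ℤ => (z : ZMod 8)) hsq
  push_cast at hcast
  exact key_mod_eight _ _ _ hcast

/-- in particular **no Golay pair of length `n ≡ 3 (mod 4)`** exists. [cite: SeberryYamada2020, Lemma 1.23] -/
theorem no_golayPair_of_mod_four {n : ℕ} (hn : n % 4 = 3) : ¬ ∃ a b : ℕ → ℤ, IsGolayPair n a b :=
  fun ⟨_, _, h⟩ => golay_length_mod_four h hn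

end Literature.Combinatorics.Designs.GolayPairs
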